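import Literature.Barriers.QuantumAdvantage.ChaoticDynamicsCopies
import Mathlib.Analysis.SpecialFunctions.Log.Deriv
import Mathlib.Analysis.SpecialFunctions.ExpDeriv
import Mathlib.Analysis.SpecialFunctions.Sqrt
import HarnessLib

/-!
# Barrier (worst-case family): Lewis–Eidenbenz–Nadiga–Subaşı 2024, Theorem 3 — an explicit `R = 1` quadratic ODE whose normalised solutions separate to overlap `≤ 2/√5` at `t* = 3 ln(1/ε)`

Companion of `Literature.Barriers.QuantumAdvantage.ChaoticDynamicsCopies` (the information-theoretic
core, Lemmas 1–2). HONEST FRAMING (cell `pub-qadeq`): instance-level adjudication of specific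
advantage claims; no claim about BQP vs BPP or the summit.

**Source.** D. Lewis, S. Eidenbenz, B. Nadiga, Y. Subaşı, Quantum **8**, 1509 (2024) =
arXiv:2307.09593v2 [LewisEtAl2024], §2 Theorem 3 (held text `paper:arxiv-2307.09593`, p0005 L33 –
p0006 L63): "There is a nonlinear ODE with `R ≥ 1` … such that any bounded-error quantum algorithm
that gives a quantum state with amplitudes proportional to the solution vector must have complexity
exponential in integration time. *Proof.* We define a coupled differential equation …
`du₁/dt = −u₁ + R* u₁²`, `du₂/dt = −u₂ − u₁` … For the initial conditions `u₁(0) = 1 − ε` and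
`u₂(0) = δ = √(2ε − ε²)` … [and `R* = 1`] we have the analytic solution
`u^ψ(t) = ([1 + ε eᵗ/(1−ε)]⁻¹, (e⁻ᵗ/ε){εδ − (1−ε) ln(1 − ε + eᵗε)})`. For `ε = 0` … `u^φ(t) =
(1, e⁻ᵗ − 1)` … two quantum states at initial time `|ψ₀⟩ = (1−ε)|0⟩ + δ|1⟩` and `|φ₀⟩ = |0⟩`. The
initial overlap is `⟨ψ₀|φ₀⟩ = 1 − ε` … We can then evolve for time `t* = 3 ln(1/ε)` and …
`|S_ψ(t*)| ≤ 1/ln(1/ε)` … which for `0 < ε < e⁻³ ≈ 0.05` can be bounded from above by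
`|⟨ψ(t*)|φ(t*)⟩| ≤ 2/√5`. Therefore, using Lemma 2, it is not possible to output these states with
only polynomial queries."

What is here (all PROVED, 0 named facts, 0 sorry):
* the printed closed forms `u1 ε t`, `u2 ε t` (the `ψ`-trajectory) and `v2 t = e⁻ᵗ − 1` (the
  `φ`-trajectory, `v1 ≡ 1`), with `hasDerivAt_u1`, `hasDerivAt_u2`, `hasDerivAt_v2` — they SOLVE the
  printed system with `R* = 1` — and the printed initial values (`u1_zero`, `u2_zero`, `v2_zero`);
* `five_mul_sq_le` — the elementary inequality behind `2/√5`: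
  `5(q + pr)² ≤ 4(1 + p²)(q² + r²)` for `0 ≤ p ≤ 1`, `0 ≤ q`, `3q ≤ r`;
* the normalised two-component states `unitVec2 a b` and their overlaps (`unitVec2_normSq`,
  `star_unitVec2_dotProduct`);
* `overlap_tstar_le` — **Theorem 3's estimate**: for `0 < ε ≤ e⁻³`, at `t* = 3 ln(1/ε)` the
  normalised solution states have `‖⟨ψ(t*)|φ(t*)⟩‖ ≤ 2/√5` (route: `u₁(t*) ≤ ε²`,
  `−u₂(t*) ≥ ε²(6 − 7ε) ≥ 3ε²`, `0 < 1 − ε³ ≤ 1`, then `five_mul_sq_le`);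
* `initial_overlap`, `initial_unit` — `⟨ψ₀|φ₀⟩ = 1 − ε`, both unit;
* `thm3_copies_ge` — **Theorem 3 assembled with Lemma 2** (`copies_ge_of_exact_output` of the core
  file): any `CopyAlgorithm` on `k` copies that outputs EXACTLY the normalised solution states at
  `t*` for both initial conditions has `k ≥ 1/(10ε) = e^{t*/3}/10`.

Structured summary (D-0021) — as in the core file; this module discharges, for the paper's own
`R = 1` family, the dynamical hypothesis `‖⟨u|v⟩‖ ≤ 2/√5` that the core file takes as input:
* technique_class: `CopyAlgorithm` (any trace-preserving operation on `k` input copies + any effect)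
  [cite: LewisEtAl2024, §2 Lemma 2].
* blocks: polynomial-in-`T` normalised-state output for the explicit `R = 1` quadratic system above
  (hence for the class "nonlinear ODEs with `R ≥ 1`") [cite: LewisEtAl2024, §2 Theorem 3].
* because: the two trajectories' normalised states separate to overlap `≤ 2/√5` at `t* = 3 ln(1/ε)`
  while `k` input copies of overlap `1 − ε` stay `√(2kε)`-indistinguishable [cite: LewisEtAl2024, §2].
* evasions_known: `R < 1` (dissipative) inputs — Liu et al. PNAS 2021 Thm 1 / tree
  `Literature.Analysis.ODE.Carleman`; non-state outputs [cite: LewisEtAl2024, §§1, 5].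
* scope_caveats: exact-output form (an `η`-approximate output version follows from the same core
  with `1/√5` replaced by `1/√5 − 2η`; not spelled out); the `R* > 1` rescaling remark of the printed
  proof and the chaotic Theorem 5 are not formalised; "complexity" = number of input copies /
  preparation queries.
* status: established (Quantum 2024).

## References
* [LewisEtAl2024] D. Lewis, S. Eidenbenz, B. Nadiga, Y. Subaşı, Quantum 8, 1509 (2024),
  arXiv:2307.09593v2, §2 Theorem 3 and its proof.
* [LiuEtAl2021Carleman] J.-P. Liu et al., PNAS 118 (2021) e2026805118 (the quantity `R`; Lemma 6).
-/

noncomputable section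

open scoped BigOperators ComplexOrder
open Matrix Finset

namespace Literature.Barriers.QuantumAdvantage.ChaoticDynamicsCopies

namespace Thm3

open Real
open Literature.InformationTheory.StateDiscrimination.TensorPowerDiscrimination (tensorPower)

/-! ### 1. The printed closed-form trajectories and the ODE they solve (`R* = 1`) -/

/-- `u₁^ψ(t) = [1 + ε eᵗ/(1−ε)]⁻¹ = (1−ε)/((1−ε) + ε eᵗ)`. [cite: LewisEtAl2024, §2 proof of Thm 3] -/
def u1 (ε t : ℝ) : ℝ := (1 - ε) / ((1 - ε) + ε * exp t)

/-- `u₂^ψ(t) = (e⁻ᵗ/ε){εδ − (1−ε) ln(1 − ε + eᵗε)}`, `δ = √(2ε − ε²)`, written as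
`e⁻ᵗ(δ − ((1−ε)/ε) ln((1−ε) + ε eᵗ))`. [cite: LewisEtAl2024, §2 proof of Thm 3] -/
def u2 (ε t : ℝ) : ℝ := exp (-t) * (sqrt (2 * ε - ε ^ 2) - (1 - ε) / ε * log ((1 - ε) + ε * exp t))

/-- `u₂^φ(t) = e⁻ᵗ − 1` (and `u₁^φ ≡ 1`). [cite: LewisEtAl2024, §2 proof of Thm 3] -/
def v2 (t : ℝ) : ℝ := exp (-t) - 1

/-- Plumbing. [folklore] -/
private theorem denom_pos {ε : ℝ} (hε0 : 0 < ε) (hε1 : ε < 1) (t : ℝ) : 0 < (1 - ε) + ε * exp t := by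
  have := exp_pos t; nlinarith

/-- `u₁^ψ` solves `u₁' = −u₁ + u₁²`. [cite: LewisEtAl2024, §2 Thm 3, eq. for du₁/dt with R* = 1] -/
theorem hasDerivAt_u1 {ε : ℝ} (hε0 : 0 < ε) (hε1 : ε < 1) (t : ℝ) :
    HasDerivAt (u1 ε) (-(u1 ε t) + (u1 ε t) ^ 2) t := by
  have hD := denom_pos hε0 hε1 t
  have h1 : HasDerivAt (fun s => (1 - ε) + ε * exp s) (ε * exp t) t := by
    simpa using ((hasDerivAt_exp t).const_mul ε).const_add (1 - ε)
  have h2 := (hasDerivAt_const t (1 - ε)).div h1 hD.ne'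
  have e : (0 * ((1 - ε) + ε * exp t) - (1 - ε) * (ε * exp t)) / ((1 - ε) + ε * exp t) ^ 2
      = -(u1 ε t) + (u1 ε t) ^ 2 := by
    unfold u1
    field_simp
    ring
  rw [← e]
  exact h2

/-- `u₂^ψ` solves `u₂' = −u₂ − u₁`. [cite: LewisEtAl2024, §2 Thm 3, eq. for du₂/dt] -/
theorem hasDerivAt_u2 {ε : ℝ} (hε0 : 0 < ε) (hε1 : ε < 1) (t : ℝ) :
    HasDerivAt (u2 ε) (-(u2 ε t) - u1 ε t) t := by
  have hD := denom_pos hε0 hε1 t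
  have h1 : HasDerivAt (fun s => (1 - ε) + ε * exp s) (ε * exp t) t := by
    simpa using ((hasDerivAt_exp t).const_mul ε).const_add (1 - ε)
  have hlog : HasDerivAt (fun s => log ((1 - ε) + ε * exp s)) ((ε * exp t) / ((1 - ε) + ε * exp t)) t :=
    h1.log hD.ne'
  have hinner : HasDerivAt (fun s => sqrt (2 * ε - ε ^ 2) - (1 - ε) / ε * log ((1 - ε) + ε * exp s))
      (0 - (1 - ε) / ε * ((ε * exp t) / ((1 - ε) + ε * exp t))) t :=
    (hasDerivAt_const t _).sub (hlog.const_mul _)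
  have hexp : HasDerivAt (fun s => exp (-s)) (-exp (-t)) t := by
    simpa using (hasDerivAt_neg t).exp
  have h := hexp.mul hinner
  have e : -exp (-t) * (sqrt (2 * ε - ε ^ 2) - (1 - ε) / ε * log ((1 - ε) + ε * exp t)) +
      exp (-t) * (0 - (1 - ε) / ε * (ε * exp t / ((1 - ε) + ε * exp t))) = -(u2 ε t) - u1 ε t := by
    unfold u2 u1
    have hεne : ε ≠ 0 := hε0.ne'
    have het : exp t ≠ 0 := (exp_pos t).ne'
    simp only [exp_neg]
    field_simp
    ring
  rw [← e]
  exact h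

/-- `u₂^φ` solves `u₂' = −u₂ − u₁` with `u₁^φ ≡ 1` (and `u₁^φ ≡ 1` solves `u₁' = −u₁ + u₁²`
trivially). [cite: LewisEtAl2024, §2 proof of Thm 3] -/
theorem hasDerivAt_v2 (t : ℝ) : HasDerivAt v2 (-(v2 t) - 1) t := by
  have hexp : HasDerivAt (fun s => exp (-s)) (-exp (-t)) t := by
    simpa using (hasDerivAt_neg t).exp
  have h := hexp.sub_const 1
  have e : -exp (-t) = -(v2 t) - 1 := by unfold v2; ring
  rw [← e]; exact h

/-- Printed initial data: `u₁^ψ(0) = 1 − ε`, `u₂^ψ(0) = δ = √(2ε − ε²)`, `u^φ(0) = (1, 0)`.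
[cite: LewisEtAl2024, §2 proof of Thm 3] -/
theorem u1_zero (ε : ℝ) : u1 ε 0 = 1 - ε := by
  unfold u1; rw [exp_zero]; field_simp; ring_nf
/-- `u₂^ψ(0) = δ = √(2ε − ε²)`. [cite: LewisEtAl2024, §2 proof of Thm 3] -/
theorem u2_zero (ε : ℝ) : u2 ε 0 = sqrt (2 * ε - ε ^ 2) := by
  unfold u2; simp
/-- `u₂^φ(0) = 0`. [cite: LewisEtAl2024, §2 proof of Thm 3] -/
theorem v2_zero : v2 0 = 0 := by unfold v2; simp

/-! ### 2. The values at `t* = 3 ln(1/ε)` -/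

/-- `t* = 3 ln(1/ε)`. [cite: LewisEtAl2024, §2 proof of Thm 3 ("evolve for time t* = 3 log(1/ε)")] -/
def tstar (ε : ℝ) : ℝ := 3 * log (1 / ε)

/-- `e^{t*} = ε⁻³`. [cite: LewisEtAl2024, §2 proof of Thm 3 ("e^t = 1/ε" at t = ln(1/ε); t* = 3 ln(1/ε))] -/
theorem exp_tstar {ε : ℝ} (hε0 : 0 < ε) : exp (tstar ε) = 1 / ε ^ 3 := by
  unfold tstar
  rw [← log_rpow (by positivity), exp_log (by positivity), one_div, inv_rpow hε0.le, one_div]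
  norm_cast

/-- Plumbing. [folklore] -/
private theorem exp_neg_tstar {ε : ℝ} (hε0 : 0 < ε) : exp (-tstar ε) = ε ^ 3 := by
  rw [exp_neg, exp_tstar hε0]; field_simp

/-- Plumbing. [folklore] -/
private theorem exp_tstar_div_three {ε : ℝ} (hε0 : 0 < ε) : exp (tstar ε / 3) = 1 / ε := by
  unfold tstar
  rw [mul_div_cancel_left₀ _ (by norm_num : (3:ℝ) ≠ 0), exp_log (by positivity)]

/-- `u₁^ψ(t*) ≤ ε²` (the `|0⟩`-component has decayed). [cite: LewisEtAl2024, §2 proof of Thm 3 ("the ratio S_ψ(t) tends to 0")] -/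
theorem u1_tstar_le {ε : ℝ} (hε0 : 0 < ε) (hε1 : ε < 1) : u1 ε (tstar ε) ≤ ε ^ 2 := by
  unfold u1
  rw [exp_tstar hε0, div_le_iff₀ (by have := denom_pos hε0 hε1 (tstar ε); rw [exp_tstar hε0] at this; exact this)]
  have e : ε ^ 2 * ((1 - ε) + ε * (1 / ε ^ 3)) = ε ^ 2 * (1 - ε) + 1 := by
    field_simp
  rw [e]
  nlinarith [pow_pos hε0 2]

/-- Plumbing. [folklore] -/
private theorem u1_tstar_pos {ε : ℝ} (hε0 : 0 < ε) (hε1 : ε < 1) : 0 < u1 ε (tstar ε) := by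
  unfold u1; exact div_pos (by linarith) (denom_pos hε0 hε1 _)

/-- `e⁻³ ≤ 1/4` (from `1 + 3 ≤ e³`), so the paper's range `0 < ε < e⁻³` lies inside `ε ≤ 1/4`. [folklore] -/
private theorem le_quarter_of_le_exp_neg_three {ε : ℝ} (hε1 : ε ≤ exp (-3)) : ε ≤ 1 / 4 := by
  refine hε1.trans ?_
  have h3 : (4 : ℝ) ≤ exp 3 := by have := add_one_le_exp (3 : ℝ); linarith
  rw [exp_neg, inv_le_comm₀ (exp_pos 3) (by norm_num)]
  linarith

/-- `−u₂^ψ(t*) ≥ ε²(6(1−ε) − ε)`: from `ln((1−ε) + ε e^{t*}) ≥ ln(ε⁻²) = 2 ln(1/ε) ≥ 6` and `δ ≤ 1`.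
[cite: LewisEtAl2024, §2 proof of Thm 3 (the bound |S_ψ(t*)| ≤ 1/ln(1/ε))] -/
theorem neg_u2_tstar_ge {ε : ℝ} (hε0 : 0 < ε) (hε1 : ε ≤ exp (-3)) :
    ε ^ 2 * (6 * (1 - ε) - ε) ≤ -(u2 ε (tstar ε)) := by
  have hε1' : ε < 1 := by have := le_quarter_of_le_exp_neg_three hε1; linarith
  have hL : 3 ≤ log (1 / ε) := by
    rw [le_log_iff_exp_le (by positivity), one_div, le_inv_comm₀ (exp_pos _) hε0, ← exp_neg]
    exact hε1
  have hδ : sqrt (2 * ε - ε ^ 2) ≤ 1 := by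
    rw [sqrt_le_one]; nlinarith
  -- the log term
  have harg : (1 / ε) ^ 2 ≤ (1 - ε) + ε * exp (tstar ε) := by
    have e : ε * (1 / ε ^ 3) = (1 / ε) ^ 2 := by field_simp
    rw [exp_tstar hε0, e]; linarith
  have hlog : 2 * log (1 / ε) ≤ log ((1 - ε) + ε * exp (tstar ε)) := by
    have e : 2 * log (1 / ε) = log ((1 / ε) ^ 2) := by rw [log_pow]; norm_num
    rw [e]
    exact log_le_log (by positivity) harg
  unfold u2
  rw [exp_neg_tstar hε0]
  have hpos : 0 ≤ (1 - ε) / ε := by apply div_nonneg <;> linarith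
  have key : (1 - ε) / ε * (2 * log (1 / ε)) ≤ (1 - ε) / ε * log ((1 - ε) + ε * exp (tstar ε)) :=
    mul_le_mul_of_nonneg_left hlog hpos
  have key2 : (1 - ε) / ε * (2 * 3) ≤ (1 - ε) / ε * (2 * log (1 / ε)) :=
    mul_le_mul_of_nonneg_left (by linarith) hpos
  have e : ε ^ 2 * (6 * (1 - ε) - ε) = ε ^ 3 * ((1 - ε) / ε * (2 * 3) - 1) := by
    field_simp; ring
  rw [e, ← mul_neg, neg_sub]
  exact mul_le_mul_of_nonneg_left (by linarith) (by positivity)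

/-! ### 3. The `2/√5` inequality -/

/-- `5(q + pr)² ≤ 4(1 + p²)(q² + r²)` for `0 ≤ p ≤ 1`, `0 ≤ q`, `3q ≤ r` (concave in `p`; the
endpoint values are `4r² − q² ≥ 0` and `(3q − r)(q − 3r) ≥ 0`; equality at `p = 1`, `r = 3q`).
[cite: LewisEtAl2024, §2 proof of Thm 3 (the final estimate ≤ 2/√5)] -/
theorem five_mul_sq_le {p q r : ℝ} (hp0 : 0 ≤ p) (hp1 : p ≤ 1) (hq : 0 ≤ q) (hqr : 3 * q ≤ r) :
    5 * (q + p * r) ^ 2 ≤ 4 * (1 + p ^ 2) * (q ^ 2 + r ^ 2) := by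
  have hr : 0 ≤ r := by linarith
  have e : 4 * (1 + p ^ 2) * (q ^ 2 + r ^ 2) - 5 * (q + p * r) ^ 2
      = (1 - p) * (4 * r ^ 2 - q ^ 2) + p * ((3 * q - r) * (q - 3 * r)) + p * (1 - p) * (r ^ 2 - 4 * q ^ 2) := by
    ring
  have h1 : 0 ≤ (1 - p) * (4 * r ^ 2 - q ^ 2) := mul_nonneg (by linarith) (by nlinarith)
  have h2 : 0 ≤ p * ((3 * q - r) * (q - 3 * r)) := mul_nonneg hp0 (mul_nonneg_of_nonpos_of_nonpos (by linarith) (by linarith))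
  have h3 : 0 ≤ p * (1 - p) * (r ^ 2 - 4 * q ^ 2) := mul_nonneg (mul_nonneg hp0 (by linarith)) (by nlinarith)
  nlinarith

/-! ### 4. Normalised two-component states and their overlaps -/

/-- The unit state `(a|0⟩ + b|1⟩)/√(a² + b²)` with real amplitudes, as a vector `Fin 2 → ℂ`.
[cite: LewisEtAl2024, §2 proof of Thm 3 ("|φ(t)⟩ = (S_φ(t)|0⟩ + |1⟩)/√(1 + S_φ(t)²)")] -/
def unitVec2 (a b : ℝ) : Fin 2 → ℂ := ![((a / sqrt (a ^ 2 + b ^ 2) : ℝ) : ℂ), ((b / sqrt (a ^ 2 + b ^ 2) : ℝ) : ℂ)]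

/-- Plumbing. [folklore] -/
private theorem star_unitVec2_dotProduct (a b c d : ℝ) :
    star (unitVec2 a b) ⬝ᵥ unitVec2 c d =
      (((a * c + b * d) / (sqrt (a ^ 2 + b ^ 2) * sqrt (c ^ 2 + d ^ 2)) : ℝ) : ℂ) := by
  unfold unitVec2
  simp only [dotProduct, Fin.sum_univ_two, Pi.star_apply, cons_val_zero, cons_val_one,
    Complex.star_def, Complex.conj_ofReal]
  push_cast
  ring

/-- Plumbing. [folklore] -/
private theorem unitVec2_normSq {a b : ℝ} (h : a ^ 2 + b ^ 2 ≠ 0) :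
    star (unitVec2 a b) ⬝ᵥ unitVec2 a b = 1 := by
  rw [star_unitVec2_dotProduct]
  have hs : 0 < sqrt (a ^ 2 + b ^ 2) := sqrt_pos.mpr (lt_of_le_of_ne (by positivity) (Ne.symm h))
  have : (a * a + b * b) / (sqrt (a ^ 2 + b ^ 2) * sqrt (a ^ 2 + b ^ 2)) = 1 := by
    rw [← pow_two, ← pow_two] ; rw [show sqrt (a^2+b^2) * sqrt (a^2+b^2) = a^2+b^2 from mul_self_sqrt (by positivity)]
    exact div_self h
  rw [this]; norm_cast

/-- Norm of the overlap of two such states: `|ac + bd| / (√(a²+b²) √(c²+d²))`. [folklore] -/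
private theorem norm_overlap_unitVec2 (a b c d : ℝ) :
    ‖star (unitVec2 a b) ⬝ᵥ unitVec2 c d‖ = |a * c + b * d| / (sqrt (a ^ 2 + b ^ 2) * sqrt (c ^ 2 + d ^ 2)) := by
  rw [star_unitVec2_dotProduct, Complex.norm_real, Real.norm_eq_abs, abs_div,
    abs_of_nonneg (mul_nonneg (sqrt_nonneg _) (sqrt_nonneg _))]

/-- From `5(ac + bd)² ≤ 4(a²+b²)(c²+d²)` to `‖⟨·|·⟩‖ ≤ 2/√5`. [folklore] -/
private theorem norm_overlap_le_of_sq {a b c d : ℝ} (hab : 0 < a ^ 2 + b ^ 2) (hcd : 0 < c ^ 2 + d ^ 2)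
    (h : 5 * (a * c + b * d) ^ 2 ≤ 4 * ((a ^ 2 + b ^ 2) * (c ^ 2 + d ^ 2))) :
    ‖star (unitVec2 a b) ⬝ᵥ unitVec2 c d‖ ≤ 2 / sqrt 5 := by
  rw [norm_overlap_unitVec2]
  have hden : 0 < sqrt (a ^ 2 + b ^ 2) * sqrt (c ^ 2 + d ^ 2) := by positivity
  rw [div_le_div_iff₀ hden (by positivity)]
  -- compare squares
  have h5 : (0:ℝ) < sqrt 5 := by positivity
  have lhs_nn : 0 ≤ |a * c + b * d| * sqrt 5 := by positivity
  have rhs_nn : 0 ≤ 2 * (sqrt (a ^ 2 + b ^ 2) * sqrt (c ^ 2 + d ^ 2)) := by positivity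
  rw [← abs_of_nonneg lhs_nn, ← abs_of_nonneg rhs_nn, ← sq_le_sq, mul_pow, mul_pow, mul_pow,
    sq_abs, sq_sqrt (by norm_num : (0:ℝ) ≤ 5), sq_sqrt hab.le, sq_sqrt hcd.le]
  linarith

/-! ### 5. Theorem 3: initial data, the `t*` overlap bound, and the assembled copy lower bound -/

/-- Initial states: `|ψ₀⟩ = (1−ε)|0⟩ + δ|1⟩` and `|φ₀⟩ = |0⟩` as `unitVec2` (both already unit:
`(1−ε)² + δ² = 1`). [cite: LewisEtAl2024, §2 proof of Thm 3] -/
def psi0 (ε : ℝ) : Fin 2 → ℂ := unitVec2 (1 - ε) (sqrt (2 * ε - ε ^ 2))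
/-- `|φ₀⟩ = |0⟩`. [cite: LewisEtAl2024, §2 proof of Thm 3] -/
def phi0 : Fin 2 → ℂ := unitVec2 1 0
/-- The normalised `ψ`-solution state at time `t`, `(u₁^ψ(t)|0⟩ + u₂^ψ(t)|1⟩)/‖u^ψ(t)‖` ("a quantum state with amplitudes proportional to the solution vector"). [cite: LewisEtAl2024, §2 proof of Thm 3] -/
def psiT (ε t : ℝ) : Fin 2 → ℂ := unitVec2 (u1 ε t) (u2 ε t)
/-- The normalised `φ`-solution state at time `t`, `(|0⟩ + (e⁻ᵗ − 1)|1⟩)/√(1 + (e⁻ᵗ−1)²)`. [cite: LewisEtAl2024, §2 proof of Thm 3] -/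
def phiT (t : ℝ) : Fin 2 → ℂ := unitVec2 1 (v2 t)

/-- Plumbing. [folklore] -/
private theorem psi0_normSq_aux {ε : ℝ} (hε0 : 0 < ε) (hε1 : ε < 1) :
    (1 - ε) ^ 2 + sqrt (2 * ε - ε ^ 2) ^ 2 = 1 := by
  rw [sq_sqrt (by nlinarith)]; ring

/-- `|ψ₀⟩` is a unit vector (`(1−ε)² + δ² = 1`). [cite: LewisEtAl2024, §2 proof of Thm 3] -/
theorem psi0_unit {ε : ℝ} (hε0 : 0 < ε) (hε1 : ε < 1) : star (psi0 ε) ⬝ᵥ psi0 ε = 1 :=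
  unitVec2_normSq (by rw [psi0_normSq_aux hε0 hε1]; norm_num)

/-- `|φ₀⟩` is a unit vector. [cite: LewisEtAl2024, §2 proof of Thm 3] -/
theorem phi0_unit : star phi0 ⬝ᵥ phi0 = 1 := unitVec2_normSq (by norm_num)

/-- **`⟨ψ₀|φ₀⟩ = 1 − ε`.** [cite: LewisEtAl2024, §2 proof of Thm 3 ("The initial overlap is ⟨ψ₀|φ₀⟩ = 1 − ε")] -/
theorem initial_overlap {ε : ℝ} (hε0 : 0 < ε) (hε1 : ε < 1) :
    star (psi0 ε) ⬝ᵥ phi0 = ((1 - ε : ℝ) : ℂ) := by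
  unfold psi0 phi0
  rw [star_unitVec2_dotProduct, psi0_normSq_aux hε0 hε1]
  norm_num

/-- `|ψ(t)⟩` is a unit vector. [cite: LewisEtAl2024, §2 proof of Thm 3] -/
theorem psiT_unit {ε : ℝ} (hε0 : 0 < ε) (hε1 : ε < 1) (t : ℝ) : star (psiT ε t) ⬝ᵥ psiT ε t = 1 := by
  have h1 : 0 < u1 ε t := by unfold u1; exact div_pos (by linarith) (denom_pos hε0 hε1 _)
  exact unitVec2_normSq (add_pos_of_pos_of_nonneg (pow_pos h1 2) (sq_nonneg _)).ne'

/-- `|φ(t)⟩` is a unit vector. [cite: LewisEtAl2024, §2 proof of Thm 3] -/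
theorem phiT_unit (t : ℝ) : star (phiT t) ⬝ᵥ phiT t = 1 := unitVec2_normSq (by positivity)

/-- **Theorem 3's estimate: `‖⟨ψ(t*)|φ(t*)⟩‖ ≤ 2/√5` for `0 < ε ≤ e⁻³`, `t* = 3 ln(1/ε)`.**
[cite: LewisEtAl2024, §2 proof of Thm 3 ("|⟨ψ(t*)|φ(t*)⟩| ≤ 2/√5")] -/
theorem overlap_tstar_le {ε : ℝ} (hε0 : 0 < ε) (hε1 : ε ≤ exp (-3)) :
    ‖star (psiT ε (tstar ε)) ⬝ᵥ phiT (tstar ε)‖ ≤ 2 / sqrt 5 := by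
  -- `e^{-3} ≤ 1/4` (from `3 + 1 ≤ e^3`), so `ε ≤ 1/4`
  have hε4 : ε ≤ 1 / 4 := le_quarter_of_le_exp_neg_three hε1
  have hε1' : ε < 1 := by linarith
  have hq0 : 0 < u1 ε (tstar ε) := u1_tstar_pos hε0 hε1'
  have hqε : u1 ε (tstar ε) ≤ ε ^ 2 := u1_tstar_le hε0 hε1'
  have hrge : ε ^ 2 * (6 * (1 - ε) - ε) ≤ -(u2 ε (tstar ε)) := neg_u2_tstar_ge hε0 hε1
  have hqr : 3 * u1 ε (tstar ε) ≤ -(u2 ε (tstar ε)) := by nlinarith [pow_pos hε0 2]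
  have hε3 : ε ^ 3 < 1 := by nlinarith [pow_pos hε0 3, pow_pos hε0 2]
  have hp0 : 0 ≤ 1 - ε ^ 3 := by linarith
  have hp1 : 1 - ε ^ 3 ≤ 1 := by nlinarith [pow_pos hε0 3]
  have hv2 : v2 (tstar ε) = -(1 - ε ^ 3) := by unfold v2; rw [exp_neg_tstar hε0]; ring
  have key := five_mul_sq_le hp0 hp1 hq0.le hqr
  unfold psiT phiT
  rw [hv2]
  apply norm_overlap_le_of_sq (add_pos_of_pos_of_nonneg (pow_pos hq0 2) (sq_nonneg _)) (by positivity)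
  have e1 : u1 ε (tstar ε) * 1 + u2 ε (tstar ε) * -(1 - ε ^ 3)
      = u1 ε (tstar ε) + (1 - ε ^ 3) * -(u2 ε (tstar ε)) := by ring
  have e2 : (u1 ε (tstar ε) ^ 2 + u2 ε (tstar ε) ^ 2) * (1 ^ 2 + (-(1 - ε ^ 3)) ^ 2)
      = (1 + (1 - ε ^ 3) ^ 2) * (u1 ε (tstar ε) ^ 2 + (-(u2 ε (tstar ε))) ^ 2) := by ring
  rw [e1, e2]
  linarith

/-- **Theorem 3 (assembled with Lemma 2).** For `0 < ε ≤ e⁻³`, any trace-preserving quantum algorithm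
that consumes `k` copies of the initial state and outputs EXACTLY the normalised solution state at
`t* = 3 ln(1/ε)` of the system `u₁' = −u₁ + u₁²`, `u₂' = −u₂ − u₁` — for both admissible initial
conditions `|ψ₀⟩`, `|φ₀⟩` (overlap `1 − ε`) — needs `k ≥ 1/(10ε) = e^{t*/3}/10`: exponential in the
integration time. [cite: LewisEtAl2024, §2 Theorem 3 with Lemma 2] -/
theorem thm3_copies_ge {ε : ℝ} (hε0 : 0 < ε) (hε1 : ε ≤ exp (-3)) {k : ℕ} {ι : Type*}
    [Fintype ι] (𝓐 : CopyAlgorithm k (Fin 2) (Fin 2) ι)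
    (hout : 𝓐.output (tensorPower (psi0 ε) k)
      = vecMulVec (psiT ε (tstar ε)) (star (psiT ε (tstar ε))))
    (hout' : 𝓐.output (tensorPower phi0 k)
      = vecMulVec (phiT (tstar ε)) (star (phiT (tstar ε)))) :
    1 / (10 * ε) ≤ k ∧ exp (tstar ε / 3) / 10 ≤ k := by
  have hε1' : ε < 1 := by have := le_quarter_of_le_exp_neg_three hε1; linarith
  have hov : 1 - ε ≤ ‖star (psi0 ε) ⬝ᵥ phi0‖ := by
    rw [initial_overlap hε0 hε1', Complex.norm_real, Real.norm_eq_abs, abs_of_nonneg (by linarith)]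
  have h := copies_ge_of_exact_output 𝓐 (psi0_unit hε0 hε1') phi0_unit hε0 hov
    (psiT_unit hε0 hε1' _) (phiT_unit _) (overlap_tstar_le hε0 hε1) hout hout'
  refine ⟨h, ?_⟩
  rw [exp_tstar_div_three hε0]
  have e : 1 / ε / 10 = 1 / (10 * ε) := by field_simp
  rw [e]; exact h

end Thm3

end Literature.Barriers.QuantumAdvantage.ChaoticDynamicsCopies

end
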